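import Mathlib
import Literature.Computability.AlgebraicComplexity.MS21SigmaPiAffStrictProofs
import HarnessLib

/-!
# Medini–Shpilka 2021, Thm 42 (strictness `ΣΠ^{GLaff} ⊊ ΣΠΣ`), part 3: EVERY infinite field —
# discharge of `MS2021_thm_42_strict` by the cubic-slot witness

Sequel of `MS21SigmaPiAffStrictWitness.lean` / `MS21SigmaPiAffStrictProofs.lean` (which proved the
slice `char F ≠ 2` with the witness `e_k(x_1², …, x_n²)`, a square in characteristic `2`). Here the
named fact `MS2021_thm_42_strict` of `MS21DenseOrbitsHittingSets.lean` (CCC 2021 LIPIcs 200:19 Thm 42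
= arXiv:2102.05632 Thm 1.26: for every infinite field, `ΣΠ^{GLaff}(F) ≠ ΣΠΣ(F)`) is DISCHARGED BY
NAME (`MS2021_thm_42_strict_holds`), uniformly in the characteristic, with the CUBIC-slot witness

  `V_{n,k} := e_k(x_1²(x_1+1), …, x_n²(x_n+1))`,  `k = n/36`.

Disclosed deviation from the printed proof (§6, p0034:L10-L26: `σ_d` + Nisan–Wigderson's
partial-derivative rank, which needs full-rank theorems for set-disjointness matrices over the field):
* `V_{n,k} ∈ Σ^{[n+1]}Π^{[3n+1]}Σ` (`isSPS_cubicWitness`): Ben-Or interpolation of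
  `∏_i (x_i²(x_i+1) + Y)` at `n+1` values `Y_j = p_j q_j r_j` where `x³ + x² + Y_j =
  (x+p_j)(x+q_j)(x+r_j)` SPLITS into affine factors — the triples come from the rational
  parametrisation `((1+λ), λ(1+λ), -λ)/(1+λ+λ²)` of the curve `{e₁ = 1, e₂ = 0}`
  (`exists_split_params`; infinitely many distinct products since each fibre lies in the roots of a
  nonzero sextic);
* the `C(n,k)` shifts `V_{n,k}(x - 1_S)`, `|S| = k`, are linearly independent over EVERY field
  (`linearIndependent_shift_cubicWitness`): the shifted slots are `x(x-1)²` (on `S`) and `x²(x+1)`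
  (off `S`), so the coefficient of `∏_{i∈S₀} x_i` is `[S = S₀]` — no factor `2`;
* the shift-span bound of part 2 (`Thm42Strict.card_le_card_support_mul_two_pow`) then gives
  `C(36k, k) ≤ m(36k) · 8^k` for the sparsity bound `m` of a putative `ΣΠ^{GLaff}` representation,
  impossible for p-bounded `m` (`35^k ≤ C(36k,k)`).

Theorem-only file (no definitions, no new named fact); `VP ≠ VNP` is NOT proved and nothing here bears
on it beyond discharging a typed literature statement by name.

## References
* [MediniShpilka2021] D. Medini, A. Shpilka, CCC 2021, LIPIcs 200:19, Thm 42 (= arXiv:2102.05632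
  Thm 1.26, p0008:L70-L72; proof §6, p0034:L10-L26).
-/

noncomputable section

open MvPolynomial Matrix

namespace Literature.Computability.AlgebraicComplexity

namespace MS2021

namespace Thm42StrictAll

variable {K : Type*} [Field K]

/-! ### Ben-Or interpolation with arbitrary slots -/

/-- `∏_i (q_i + t) = ∑_{T ⊆ [n]} (∏_{i ∈ T} q_i) · t^{n - |T|}`. [cite: MediniShpilka2021, §6 proof of Thm 42 (interpolation of ∏ (Y + x_i); arXiv p0034:L24-L26)] -/
theorem prod_add_C {n : ℕ} (q : Fin n → MvPolynomial (Fin n) K) (t : K) :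
    ∏ i : Fin n, (q i + C t) =
      ∑ T ∈ (Finset.univ : Finset (Fin n)).powerset, (∏ i ∈ T, q i) * C (t ^ (n - T.card)) := by
  classical
  rw [Finset.prod_add]
  refine Finset.sum_congr rfl fun T hT => ?_
  rw [Finset.prod_const, Finset.card_sdiff_of_subset (Finset.mem_powerset.mp hT), Finset.card_univ,
    Fintype.card_fin, C_pow]

/-- The interpolated sum with Lagrange coefficients for the exponent `n - k`:
`∑_j c_j ∏_i (q_i + t_j) = e_k(q_1, …, q_n)`. [cite: MediniShpilka2021, §6 proof of Thm 42 (arXiv p0034:L24-L26)] -/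
theorem sum_C_mul_prod_add_C {n k : ℕ} (hk : k ≤ n) (q : Fin n → MvPolynomial (Fin n) K)
    (t c : Fin (n + 1) → K)
    (hc : ∀ e : Fin (n + 1), ∑ j, c j * t j ^ (e : ℕ) = if e = ⟨n - k, by omega⟩ then 1 else 0) :
    ∑ j : Fin (n + 1), C (c j) * ∏ i : Fin n, (q i + C (t j)) =
      ∑ T ∈ (Finset.univ : Finset (Fin n)).powersetCard k, ∏ i ∈ T, q i := by
  classical
  simp_rw [prod_add_C, Finset.mul_sum]
  rw [Finset.sum_comm]
  have key : ∀ T ∈ (Finset.univ : Finset (Fin n)).powerset,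
      ∑ j : Fin (n + 1), C (c j) * ((∏ i ∈ T, q i) * C (t j ^ (n - T.card))) =
      if T.card = k then ∏ i ∈ T, q i else 0 := by
    intro T hT
    have hTn : T.card ≤ n := by
      simpa using Finset.card_le_card (Finset.mem_powerset.mp hT)
    have hsum : ∑ j : Fin (n + 1), C (c j) * ((∏ i ∈ T, q i) * C (t j ^ (n - T.card))) =
        (∏ i ∈ T, q i) * C (∑ j : Fin (n + 1), c j * t j ^ (n - T.card)) := by
      rw [map_sum, Finset.mul_sum]
      refine Finset.sum_congr rfl fun j _ => ?_
      rw [map_mul]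
      ring
    rw [hsum]
    have hc' := hc ⟨n - T.card, by omega⟩
    simp only [Fin.mk.injEq] at hc'
    rw [hc']
    by_cases hTk : T.card = k
    · rw [if_pos (by omega), if_pos hTk, map_one, mul_one]
    · rw [if_neg (by omega), if_neg hTk, map_zero, mul_zero]
  rw [Finset.sum_congr rfl key, ← Finset.sum_filter, Finset.powersetCard_eq_filter]

/-! ### Split cubics `x³ + x² + Y = (x + p)(x + q)(x + r)` for infinitely many `Y` (every infinite field) -/

/-- The rational parametrisation `λ ↦ ((1+λ), λ(1+λ), -λ)/(1+λ+λ²)` of the curve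
`{p + q + r = 1, pq + pr + qr = 0}`: for every `λ` with `1 + λ + λ² ≠ 0` it gives such a triple, with
product `-λ²(1+λ)²/(1+λ+λ²)³`. [folklore] -/
private theorem split_params_of_lambda (l : K) (hD : 1 + l + l ^ 2 ≠ 0) :
    (1 + l) / (1 + l + l ^ 2) + l * (1 + l) / (1 + l + l ^ 2) + -l / (1 + l + l ^ 2) = 1 ∧
    (1 + l) / (1 + l + l ^ 2) * (l * (1 + l) / (1 + l + l ^ 2)) +
      (1 + l) / (1 + l + l ^ 2) * (-l / (1 + l + l ^ 2)) +
      l * (1 + l) / (1 + l + l ^ 2) * (-l / (1 + l + l ^ 2)) = 0 ∧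
    (1 + l) / (1 + l + l ^ 2) * (l * (1 + l) / (1 + l + l ^ 2)) * (-l / (1 + l + l ^ 2)) =
      -(l ^ 2 * (1 + l) ^ 2) / (1 + l + l ^ 2) ^ 3 := by
  refine ⟨?_, ?_, ?_⟩
  · field_simp
    ring
  · field_simp
    ring
  · field_simp

/-- The set of products `-λ²(1+λ)²/(1+λ+λ²)³`, `1 + λ + λ² ≠ 0`, is infinite in an infinite field
(the excluded `λ` are roots of `X² + X + 1`, each fibre lies in the roots of a nonzero sextic).
[folklore] -/
private theorem infinite_range_e3 [Infinite K] :
    (Set.range fun l : {l : K // 1 + l + l ^ 2 ≠ 0} =>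
      -((l : K) ^ 2 * (1 + (l : K)) ^ 2) / (1 + (l : K) + (l : K) ^ 2) ^ 3).Infinite := by
  classical
  intro hfin
  -- the bad parameters
  have hbad : ({l : K | 1 + l + l ^ 2 = 0}).Finite := by
    have hP : (1 + Polynomial.X + Polynomial.X ^ 2 : Polynomial K) ≠ 0 := by
      intro h
      have := congr_arg (Polynomial.eval 0) h
      simp at this
    refine ((1 + Polynomial.X + Polynomial.X ^ 2 : Polynomial K).roots.toFinset.finite_toSet).subset
      fun l hl => ?_
    simp only [Set.mem_setOf_eq] at hl
    simp only [Finset.mem_coe, Multiset.mem_toFinset, Polynomial.mem_roots hP, Polynomial.IsRoot.def]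
    simp [hl]
  -- each fibre is finite
  have hfib : ∀ y : K, ({l : K | 1 + l + l ^ 2 ≠ 0 ∧
      -(l ^ 2 * (1 + l) ^ 2) / (1 + l + l ^ 2) ^ 3 = y}).Finite := by
    intro y
    set Q : Polynomial K := Polynomial.X ^ 2 * (1 + Polynomial.X) ^ 2 +
      Polynomial.C y * (1 + Polynomial.X + Polynomial.X ^ 2) ^ 3 with hQ
    have hQ0 : Q ≠ 0 := by
      by_cases hy : y = 0
      · rw [hQ, hy, map_zero, zero_mul, add_zero]
        exact mul_ne_zero (pow_ne_zero 2 Polynomial.X_ne_zero)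
          (pow_ne_zero 2 (by
            rw [add_comm]
            exact Polynomial.X_add_C_ne_zero 1))
      · intro h
        have := congr_arg (Polynomial.eval 0) h
        simp [hQ] at this
        exact hy this
    refine (Q.roots.toFinset.finite_toSet).subset fun l hl => ?_
    obtain ⟨hD, hy⟩ := hl
    simp only [Finset.mem_coe, Multiset.mem_toFinset, Polynomial.mem_roots hQ0, Polynomial.IsRoot.def]
    rw [div_eq_iff (pow_ne_zero 3 hD)] at hy
    simp only [hQ, Polynomial.eval_add, Polynomial.eval_mul, Polynomial.eval_pow, Polynomial.eval_X,
      Polynomial.eval_C, Polynomial.eval_one]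
    linear_combination (-1 : K) * hy
  -- cover `K` by the bad set and the fibres over the (finite) range
  have hcov : (Set.univ : Set K) ⊆ {l : K | 1 + l + l ^ 2 = 0} ∪
      ⋃ y ∈ Set.range (fun l : {l : K // 1 + l + l ^ 2 ≠ 0} =>
        -((l : K) ^ 2 * (1 + (l : K)) ^ 2) / (1 + (l : K) + (l : K) ^ 2) ^ 3),
        {l : K | 1 + l + l ^ 2 ≠ 0 ∧ -(l ^ 2 * (1 + l) ^ 2) / (1 + l + l ^ 2) ^ 3 = y} := by
    intro l _
    by_cases hD : 1 + l + l ^ 2 = 0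
    · exact Or.inl hD
    · refine Or.inr (Set.mem_iUnion₂.mpr ⟨_, ⟨⟨l, hD⟩, rfl⟩, hD, rfl⟩)
  exact Set.infinite_univ (α := K)
    ((hbad.union (hfin.biUnion fun y _ => hfib y)).subset hcov)

/-- **Split cubics.** In an infinite field there are `N` triples `(p_j, q_j, r_j)` with `p + q + r = 1`,
`pq + pr + qr = 0` and pairwise distinct products `p q r` — so that `x³ + x² + p_j q_j r_j =
(x + p_j)(x + q_j)(x + r_j)` splits into AFFINE factors at `N` distinct interpolation values.
[cite: MediniShpilka2021, §6 proof of Thm 42 (ΣΠΣ circuits by interpolation over a field with ≥ n+1 elements; arXiv p0034:L24-L26)] -/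
theorem exists_split_params [Infinite K] (N : ℕ) :
    ∃ p q r : Fin N → K, (∀ j, p j + q j + r j = 1) ∧ (∀ j, p j * q j + p j * r j + q j * r j = 0) ∧
      Function.Injective (fun j => p j * q j * r j) := by
  classical
  let emb := (infinite_range_e3 (K := K)).natEmbedding
  have hpre : ∀ j : Fin N, ∃ l : {l : K // 1 + l + l ^ 2 ≠ 0},
      -((l : K) ^ 2 * (1 + (l : K)) ^ 2) / (1 + (l : K) + (l : K) ^ 2) ^ 3 = (emb j : K) :=
    fun j => (emb j).2
  choose l hl using hpre
  refine ⟨fun j => (1 + (l j : K)) / (1 + (l j : K) + (l j : K) ^ 2),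
    fun j => (l j : K) * (1 + (l j : K)) / (1 + (l j : K) + (l j : K) ^ 2),
    fun j => -(l j : K) / (1 + (l j : K) + (l j : K) ^ 2),
    fun j => (split_params_of_lambda (l j : K) (l j).2).1,
    fun j => (split_params_of_lambda (l j : K) (l j).2).2.1, fun j j' hjj' => ?_⟩
  have h3 := (split_params_of_lambda (l j : K) (l j).2).2.2
  have h3' := (split_params_of_lambda (l j' : K) (l j').2).2.2
  have heq : (emb j : K) = emb j' := by
    rw [← hl j, ← hl j', ← h3, ← h3']
    exact hjj'
  exact Fin.ext (emb.injective (Subtype.ext heq))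

/-! ### The cubic-slot witness `V_{n,k} = e_k(x_1²(x_1+1), …, x_n²(x_n+1))` is a `ΣΠΣ` circuit -/

/-- The affine form with coefficient vector "indicator of `i`" and constant `e` is `x_i + e`. [folklore] -/
private theorem affine_form_single {n : ℕ} (i : Fin n) (e : K) :
    (C e + ∑ m : Fin n, C (if m = i then (1 : K) else 0) * (X m : MvPolynomial (Fin n) K)) =
      X i + C e := by
  classical
  have h : ∀ m : Fin n, C (if m = i then (1 : K) else 0) * (X m : MvPolynomial (Fin n) K) =
      if m = i then X m else 0 := fun m => by
    split_ifs <;> simp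
  simp_rw [h]
  rw [Finset.sum_ite_eq' Finset.univ i, if_pos (Finset.mem_univ i), add_comm]

/-- `x³ + x² + pqr = (x + p)(x + q)(x + r)` when `p + q + r = 1` and `pq + pr + qr = 0`. [folklore] -/
private theorem cubic_split {n : ℕ} (i : Fin n) {p q r : K} (h1 : p + q + r = 1)
    (h2 : p * q + p * r + q * r = 0) :
    (X i : MvPolynomial (Fin n) K) ^ 3 + X i ^ 2 + C (p * q * r) =
      (X i + C p) * (X i + C q) * (X i + C r) := by
  have key : (X i + C p) * (X i + C q) * (X i + C r) =
      (X i : MvPolynomial (Fin n) K) ^ 3 + C (p + q + r) * X i ^ 2 + C (p * q + p * r + q * r) * X i +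
        C (p * q * r) := by
    simp only [map_add, map_mul]
    ring
  rw [key, h1, h2, map_one, map_zero, one_mul, zero_mul, add_zero]

/-- **The cubic-slot witness is a `Σ^{[n+1]}Π^{[3n+1]}Σ` circuit** over every infinite field:
product gate `j` multiplies the `3n` affine forms `x_i + p_j`, `x_i + q_j`, `x_i + r_j` and the
constant `c_j`. [cite: MediniShpilka2021, Thm 42 / §6 (arXiv p0034:L24-L26: ΣΠΣ circuits by interpolation)] -/
theorem isSPS_cubicWitness [Infinite K] {n k : ℕ} (hk : k ≤ n) :
    IsSPS (n + 1) (n + n + n + 1)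
      (∑ T ∈ (Finset.univ : Finset (Fin n)).powersetCard k,
        ∏ i ∈ T, ((X i : MvPolynomial (Fin n) K) ^ 3 + X i ^ 2)) := by
  classical
  obtain ⟨p, q, r, h1, h2, hinj⟩ := exists_split_params (K := K) (n + 1)
  obtain ⟨c, hc⟩ := Thm42Strict.exists_interpolation_coeffs (fun j => p j * q j * r j) hinj
    ⟨n - k, by omega⟩
  -- the coefficient vectors of the affine forms of product gate `j`
  let α : Fin (n + 1) → Fin (n + n + n + 1) → Option (Fin n) → K := fun j l =>
    if h : (l : ℕ) < n then fun o => o.elim (p j) fun m => if m = ⟨l, h⟩ then 1 else 0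
    else if h' : (l : ℕ) < n + n then
      fun o => o.elim (q j) fun m => if m = ⟨l - n, by omega⟩ then 1 else 0
    else if h'' : (l : ℕ) < n + n + n then
      fun o => o.elim (r j) fun m => if m = ⟨l - (n + n), by omega⟩ then 1 else 0
    else fun o => o.elim (c j) fun _ => 0
  refine ⟨α, ?_⟩
  rw [← sum_C_mul_prod_add_C hk (fun i => (X i : MvPolynomial (Fin n) K) ^ 3 + X i ^ 2)
    (fun j => p j * q j * r j) c hc]
  refine Finset.sum_congr rfl fun j _ => ?_
  rw [Fin.prod_univ_add, Fin.prod_univ_add, Fin.prod_univ_add, Fin.prod_univ_one]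
  have hP : ∀ i : Fin n, (C (α j (Fin.castAdd 1 (Fin.castAdd n (Fin.castAdd n i))) none) +
      ∑ m : Fin n, C (α j (Fin.castAdd 1 (Fin.castAdd n (Fin.castAdd n i))) (some m)) *
        (X m : MvPolynomial (Fin n) K)) = X i + C (p j) := by
    intro i
    have hi : ((Fin.castAdd 1 (Fin.castAdd n (Fin.castAdd n i)) : Fin (n + n + n + 1)) : ℕ) < n := by
      simp only [Fin.val_castAdd]; omega
    have hα0 : α j (Fin.castAdd 1 (Fin.castAdd n (Fin.castAdd n i))) none = p j := by
      simp only [α, dif_pos hi, Option.elim]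
    have hα1 : ∀ m : Fin n, α j (Fin.castAdd 1 (Fin.castAdd n (Fin.castAdd n i))) (some m) =
        if m = i then 1 else 0 := by
      intro m
      simp only [α, dif_pos hi, Option.elim]
      simp [Fin.ext_iff]
    simp_rw [hα0, hα1]
    rw [affine_form_single]
  have hQ : ∀ i : Fin n, (C (α j (Fin.castAdd 1 (Fin.castAdd n (Fin.natAdd n i))) none) +
      ∑ m : Fin n, C (α j (Fin.castAdd 1 (Fin.castAdd n (Fin.natAdd n i))) (some m)) *
        (X m : MvPolynomial (Fin n) K)) = X i + C (q j) := by
    intro i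
    have hi : ¬ ((Fin.castAdd 1 (Fin.castAdd n (Fin.natAdd n i)) : Fin (n + n + n + 1)) : ℕ) < n := by
      simp only [Fin.val_castAdd, Fin.val_natAdd]; omega
    have hi' : ((Fin.castAdd 1 (Fin.castAdd n (Fin.natAdd n i)) : Fin (n + n + n + 1)) : ℕ) <
        n + n := by simp only [Fin.val_castAdd, Fin.val_natAdd]; omega
    have hα0 : α j (Fin.castAdd 1 (Fin.castAdd n (Fin.natAdd n i))) none = q j := by
      simp only [α, dif_neg hi, dif_pos hi', Option.elim]
    have hα1 : ∀ m : Fin n, α j (Fin.castAdd 1 (Fin.castAdd n (Fin.natAdd n i))) (some m) =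
        if m = i then 1 else 0 := by
      intro m
      simp only [α, dif_neg hi, dif_pos hi', Option.elim]
      simp [Fin.ext_iff]
    simp_rw [hα0, hα1]
    rw [affine_form_single]
  have hR : ∀ i : Fin n, (C (α j (Fin.castAdd 1 (Fin.natAdd (n + n) i)) none) +
      ∑ m : Fin n, C (α j (Fin.castAdd 1 (Fin.natAdd (n + n) i)) (some m)) *
        (X m : MvPolynomial (Fin n) K)) = X i + C (r j) := by
    intro i
    have hi : ¬ ((Fin.castAdd 1 (Fin.natAdd (n + n) i) : Fin (n + n + n + 1)) : ℕ) < n := by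
      simp only [Fin.val_castAdd, Fin.val_natAdd]; omega
    have hi' : ¬ ((Fin.castAdd 1 (Fin.natAdd (n + n) i) : Fin (n + n + n + 1)) : ℕ) < n + n := by
      simp only [Fin.val_castAdd, Fin.val_natAdd]; omega
    have hi'' : ((Fin.castAdd 1 (Fin.natAdd (n + n) i) : Fin (n + n + n + 1)) : ℕ) <
        n + n + n := by simp only [Fin.val_castAdd, Fin.val_natAdd]; omega
    have hα0 : α j (Fin.castAdd 1 (Fin.natAdd (n + n) i)) none = r j := by
      simp only [α, dif_neg hi, dif_neg hi', dif_pos hi'', Option.elim]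
    have hα1 : ∀ m : Fin n, α j (Fin.castAdd 1 (Fin.natAdd (n + n) i)) (some m) =
        if m = i then 1 else 0 := by
      intro m
      simp only [α, dif_neg hi, dif_neg hi', dif_pos hi'', Option.elim]
      simp [Fin.ext_iff]
    simp_rw [hα0, hα1]
    rw [affine_form_single]
  have hC : (C (α j (Fin.natAdd (n + n + n) (0 : Fin 1)) none) +
      ∑ m : Fin n, C (α j (Fin.natAdd (n + n + n) (0 : Fin 1)) (some m)) *
        (X m : MvPolynomial (Fin n) K)) = C (c j) := by
    have hi : ¬ ((Fin.natAdd (n + n + n) (0 : Fin 1) : Fin (n + n + n + 1)) : ℕ) < n := by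
      simp only [Fin.val_natAdd]; omega
    have hi' : ¬ ((Fin.natAdd (n + n + n) (0 : Fin 1) : Fin (n + n + n + 1)) : ℕ) < n + n := by
      simp only [Fin.val_natAdd]; omega
    have hi'' : ¬ ((Fin.natAdd (n + n + n) (0 : Fin 1) : Fin (n + n + n + 1)) : ℕ) < n + n + n := by
      simp only [Fin.val_natAdd]; omega
    have hα0 : α j (Fin.natAdd (n + n + n) (0 : Fin 1)) none = c j := by
      simp only [α, dif_neg hi, dif_neg hi', dif_neg hi'', Option.elim]
    have hα1 : ∀ m : Fin n, α j (Fin.natAdd (n + n + n) (0 : Fin 1)) (some m) = 0 := by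
      intro m
      simp only [α, dif_neg hi, dif_neg hi', dif_neg hi'', Option.elim]
    simp_rw [hα0, hα1]
    simp
  simp_rw [hP, hQ, hR]
  rw [hC, ← Finset.prod_mul_distrib, ← Finset.prod_mul_distrib, mul_comm]
  congr 1
  exact Finset.prod_congr rfl fun i _ => cubic_split i (h1 j) (h2 j)

/-- `deg e_k(x_1²(x_1+1), …) ≤ 3k`. [cite: MediniShpilka2021, Thm 42 / §6 (Claim 6.1: degrees of ΣΠ^{GLaff} members)] -/
theorem totalDegree_cubicWitness_le {n k : ℕ} :
    (∑ T ∈ (Finset.univ : Finset (Fin n)).powersetCard k,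
      ∏ i ∈ T, ((X i : MvPolynomial (Fin n) K) ^ 3 + X i ^ 2)).totalDegree ≤ 3 * k := by
  classical
  have hterm : ∀ i : Fin n, ((X i : MvPolynomial (Fin n) K) ^ 3 + X i ^ 2).totalDegree ≤ 3 := by
    intro i
    refine (totalDegree_add _ _).trans (max_le ?_ ?_)
    · exact (totalDegree_pow _ _).trans (by rw [totalDegree_X])
    · exact (totalDegree_pow _ _).trans (by rw [totalDegree_X]; norm_num)
  refine totalDegree_finsetSum_le fun T hT => (totalDegree_finsetProd _ _).trans ?_
  have hcard : T.card = k := (Finset.mem_powersetCard.mp hT).2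
  show ∑ i ∈ T, ((X i : MvPolynomial (Fin n) K) ^ 3 + X i ^ 2).totalDegree ≤ 3 * k
  refine (Finset.sum_le_sum fun i _ => hterm i).trans (le_of_eq ?_)
  rw [Finset.sum_const, smul_eq_mul, hcard, mul_comm]

/-! ### Shifts of the cubic witness by `-1_S` are linearly independent in EVERY characteristic -/

/-- The indicator exponent vector `1_S` evaluated at `j`. [folklore] -/
private theorem indicator_apply {n : ℕ} (S : Finset (Fin n)) (j : Fin n) :
    (∑ i ∈ S, Finsupp.single i (1 : ℕ)) j = if j ∈ S then 1 else 0 := by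
  classical
  rw [Finsupp.finsetSum_apply]
  simp_rw [Finsupp.single_apply]
  rw [Finset.sum_ite_eq' S j]

/-- `∏_{i ∈ T} x_i` is the monomial `x^{1_T}`. [folklore] -/
private theorem prod_X_eq_monomial {n : ℕ} (T : Finset (Fin n)) :
    ∏ i ∈ T, (X i : MvPolynomial (Fin n) K) = monomial (∑ i ∈ T, Finsupp.single i 1) 1 := by
  rw [monomial_sum_one]
  rfl

/-- The shifted slot: `(x + c)³ + (x + c)² = x · v_c(x)` for `c ∈ {0, -1}`, with `v_{-1} = (x-1)²`
(constant term `1`) and `v_0 = x(x+1)` (constant term `0`). [folklore] -/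
private theorem shifted_slot_eq {n : ℕ} (S : Finset (Fin n)) (i : Fin n) :
    ((X i : MvPolynomial (Fin n) K) + C (if i ∈ S then (-1 : K) else 0)) ^ 3 +
        ((X i : MvPolynomial (Fin n) K) + C (if i ∈ S then (-1 : K) else 0)) ^ 2 =
      X i * (if i ∈ S then ((X i : MvPolynomial (Fin n) K) - 1) ^ 2 else X i * (X i + 1)) := by
  split_ifs
  · rw [map_neg, map_one]; ring
  · rw [map_zero]; ring

/-- **Coefficient of `∏_{i ∈ S₀} x_i` in the shifted cubic witness `V_{n,k}(x - 1_S)`**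
(`|S| = |S₀| = k`): `1` if `S = S₀`, else `0` — valid in EVERY characteristic (the lowest-degree
monomials of the slots are `x_i` for `i ∈ S` and `x_i²` for `i ∉ S`).
[cite: MediniShpilka2021, §6 (separation witness bookkeeping; arXiv p0034:L20-L26)] -/
theorem coeff_indicator_shift_cubicWitness {n k : ℕ} (S S₀ : Finset (Fin n)) (hS : S.card = k)
    (hS₀ : S₀.card = k) :
    coeff (∑ i ∈ S₀, Finsupp.single i 1)
      (aeval (fun i : Fin n => (X i : MvPolynomial (Fin n) K) + C (if i ∈ S then (-1 : K) else 0))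
        (∑ T ∈ (Finset.univ : Finset (Fin n)).powersetCard k,
          ∏ i ∈ T, ((X i : MvPolynomial (Fin n) K) ^ 3 + X i ^ 2))) =
      if S₀ = S then (1 : K) else 0 := by
  classical
  rw [map_sum, coeff_sum]
  simp_rw [map_prod, map_add, map_pow, aeval_X, shifted_slot_eq S, Finset.prod_mul_distrib,
    prod_X_eq_monomial]
  rw [Finset.sum_eq_single S₀]
  · -- the summand `T = S₀`: constant term of `∏_{i ∈ S₀} v_i`
    rw [coeff_monomial_mul', if_pos le_rfl, one_mul, tsub_self, ← constantCoeff_eq, map_prod]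
    have hv : ∀ i : Fin n, constantCoeff (if i ∈ S then ((X i : MvPolynomial (Fin n) K) - 1) ^ 2
        else X i * (X i + 1)) = if i ∈ S then (1 : K) else 0 := by
      intro i
      split_ifs <;> simp [constantCoeff_X]
    simp_rw [hv]
    rw [Finset.prod_boole]
    by_cases h : S₀ = S
    · subst h
      rw [if_pos (fun i hi => hi), if_pos rfl]
    · have hnot : ¬ (∀ i ∈ S₀, i ∈ S) := fun hsub =>
        h (Finset.eq_of_subset_of_card_le hsub (by rw [hS, hS₀]))
      rw [if_neg hnot, if_neg h]
  · -- the summands `T ≠ S₀` are multiples of some `x_j`, `j ∉ S₀`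
    intro T hT hTS₀
    have hTk : T.card = k := (Finset.mem_powersetCard.mp hT).2
    have hnot : ¬ T ⊆ S₀ := fun hsub =>
      hTS₀ (Finset.eq_of_subset_of_card_le hsub (by rw [hS₀, hTk]))
    obtain ⟨j, hjT, hjS₀⟩ := Finset.not_subset.mp hnot
    rw [coeff_monomial_mul', if_neg]
    intro hle
    have := hle j
    rw [indicator_apply, indicator_apply, if_pos hjT, if_neg hjS₀] at this
    omega
  · intro hS₀'
    exact absurd (Finset.mem_powersetCard.mpr ⟨Finset.subset_univ S₀, hS₀⟩) hS₀'

/-- **The `C(n,k)` shifts `V_{n,k}(x - 1_S)`, `|S| = k`, are linearly independent over EVERY field.**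
[cite: MediniShpilka2021, §6 (separation ΣΠ^{GLaff} ⊊ ΣΠΣ; arXiv p0034:L20-L26)] -/
theorem linearIndependent_shift_cubicWitness (n k : ℕ) :
    LinearIndependent K fun S : (Finset.univ : Finset (Fin n)).powersetCard k =>
      aeval (fun i : Fin n => (X i : MvPolynomial (Fin n) K) +
        C (if i ∈ (S : Finset (Fin n)) then (-1 : K) else 0))
        (∑ T ∈ (Finset.univ : Finset (Fin n)).powersetCard k,
          ∏ i ∈ T, ((X i : MvPolynomial (Fin n) K) ^ 3 + X i ^ 2)) := by
  classical
  refine linearIndependent_iff'.mpr fun s g hsum S₀ hS₀ => ?_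
  have hk : ∀ S : (Finset.univ : Finset (Fin n)).powersetCard k, (S : Finset (Fin n)).card = k :=
    fun S => (Finset.mem_powersetCard.mp S.2).2
  have h := congr_arg (coeff (∑ i ∈ (S₀ : Finset (Fin n)), Finsupp.single i 1)) hsum
  rw [coeff_sum, coeff_zero] at h
  simp_rw [smul_eq_C_mul, coeff_C_mul] at h
  rw [Finset.sum_eq_single S₀] at h
  · rw [coeff_indicator_shift_cubicWitness _ _ (hk S₀) (hk S₀), if_pos rfl, mul_one] at h
    exact h
  · intro S _ hSS₀
    rw [coeff_indicator_shift_cubicWitness _ _ (hk S) (hk S₀), if_neg, mul_zero]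
    exact fun heq => hSS₀ (Subtype.ext heq.symm)
  · intro hS₀'
    exact absurd hS₀ hS₀'

/-! ### Growth -/

/-- `35^j ≤ C(36k, j)` for `j ≤ k`. [folklore] -/
private theorem pow_le_choose_of_le (k : ℕ) : ∀ j : ℕ, j ≤ k → 35 ^ j ≤ Nat.choose (36 * k) j
  | 0, _ => by simp
  | j + 1, hj => by
    have ih := pow_le_choose_of_le k j (Nat.le_of_succ_le hj)
    have hrec := Nat.choose_succ_right_eq (36 * k) j
    have hge : 35 ^ j * (35 * (j + 1)) ≤ Nat.choose (36 * k) (j + 1) * (j + 1) := by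
      rw [hrec]
      exact Nat.mul_le_mul ih (by omega)
    have : 35 ^ (j + 1) * (j + 1) ≤ Nat.choose (36 * k) (j + 1) * (j + 1) := by
      calc 35 ^ (j + 1) * (j + 1) = 35 ^ j * (35 * (j + 1)) := by ring
        _ ≤ _ := hge
    exact Nat.le_of_mul_le_mul_right this (Nat.succ_pos j)

/-- A p-bounded function is eventually below `2^{n/36}`: `m(36k) · 8^k < 35^k` with `k = 2^{2A+14}`.
[folklore] -/
private theorem exists_lt_of_isPBounded {m : ℕ → ℕ} (hm : IsPBounded m) :
    ∃ k : ℕ, 1 ≤ k ∧ m (36 * k) * 8 ^ k < 35 ^ k := by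
  obtain ⟨A, hA1, hA⟩ := IsPBounded.exists_lt_two_pow hm
  have hA2 : A < 2 ^ A := Nat.lt_two_pow_self
  refine ⟨2 ^ (2 * A + 14), Nat.one_le_two_pow, ?_⟩
  have hlog : Nat.log 2 (36 * 2 ^ (2 * A + 14)) + 1 ≤ 2 * A + 20 := by
    have hlt : 36 * 2 ^ (2 * A + 14) < 2 ^ (2 * A + 20) := by
      have h64 : (2 : ℕ) ^ (2 * A + 20) = 2 ^ (2 * A + 14) * 64 := by
        rw [show 2 * A + 20 = (2 * A + 14) + 6 by ring, pow_add]; norm_num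
      have hpos : 0 < 2 ^ (2 * A + 14) := by positivity
      rw [h64]; omega
    have := Nat.log_lt_of_lt_pow (by positivity) hlt
    omega
  have hjA : (2 * A + 20) * A ≤ 2 ^ (2 * A + 14) := by
    have h1 : 2 * A + 20 ≤ 2 ^ (A + 5) := by
      have h32 : (2 : ℕ) ^ (A + 5) = 32 * 2 ^ A := by rw [pow_add]; norm_num; ring
      rw [h32]
      calc 2 * A + 20 ≤ 32 * (A + 1) := by omega
        _ ≤ 32 * 2 ^ A := Nat.mul_le_mul_left 32 hA2
    calc (2 * A + 20) * A ≤ 2 ^ (A + 5) * 2 ^ A := Nat.mul_le_mul h1 hA2.le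
      _ = 2 ^ (2 * A + 5) := by rw [← pow_add]; ring_nf
      _ ≤ 2 ^ (2 * A + 14) := Nat.pow_le_pow_right (by norm_num) (by omega)
  have hm' : m (36 * 2 ^ (2 * A + 14)) < 2 ^ (2 ^ (2 * A + 14)) :=
    (hA _).trans_le (Nat.pow_le_pow_right (by norm_num)
      ((Nat.mul_le_mul_right A hlog).trans hjA))
  calc m (36 * 2 ^ (2 * A + 14)) * 8 ^ 2 ^ (2 * A + 14)
      < 2 ^ (2 ^ (2 * A + 14)) * 8 ^ 2 ^ (2 * A + 14) :=
        mul_lt_mul_of_pos_right hm' (by positivity)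
    _ = 16 ^ 2 ^ (2 * A + 14) := by rw [← mul_pow]; norm_num
    _ ≤ 35 ^ 2 ^ (2 * A + 14) := Nat.pow_le_pow_left (by norm_num) _

/-! ### The discharge -/

/-- **MS Thm 42, strictness of the second inclusion, discharged for EVERY infinite field:**
`ΣΠ^{GLaff}(F) ≠ ΣΠΣ(F)`. Witness (disclosed deviation from print's `σ_d` + NW96): the family
`V_n = e_{n/36}(x_1²(x_1+1), …, x_n²(x_n+1))` — in `Σ^{[n+1]}Π^{[3n+1]}Σ` by Ben-Or interpolation with
split cubics (`isSPS_cubicWitness`), but every `g` with `V_n = g(Ax+b)` has `#supp g · 8^{n/36} ≥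
C(n, n/36)` by the shift-span count (`card_le_card_support_mul_two_pow`,
`linearIndependent_shift_cubicWitness`), which no p-bounded sparsity survives.
[cite: MediniShpilka2021, Thm 42 (CCC 2021 LIPIcs 200:19, p.19:14; = arXiv:2102.05632 Thm 1.26, p0008:L70-L72; proof §6 p0034:L10-L26)] -/
theorem sigmaPiAffClass_ne_spsClass (K : Type) [Field K] [Infinite K] :
    SigmaPiAffClass K ≠ SPSClass K := by
  classical
  intro heq
  have hW : (fun n => ∑ T ∈ (Finset.univ : Finset (Fin n)).powersetCard (n / 36),
      ∏ i ∈ T, ((X i : MvPolynomial (Fin n) K) ^ 3 + X i ^ 2)) ∈ SPSClass K := by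
    refine ⟨fun n => n + 1, fun n => n + n + n + 1,
      IsPBounded.add_holds IsPBounded.id (IsPBounded.const 1),
      IsPBounded.add_holds (IsPBounded.add_holds (IsPBounded.add_holds IsPBounded.id IsPBounded.id)
        IsPBounded.id) (IsPBounded.const 1),
      fun n => isSPS_cubicWitness (Nat.div_le_self n 36)⟩
  rw [← heq] at hW
  obtain ⟨-, m, hm, hmem⟩ := hW
  obtain ⟨k, hk1, hlt⟩ := exists_lt_of_isPBounded hm
  obtain ⟨m', g, hm'n, hsupp, hdeg, hle, A, b, hA, hWg⟩ := hmem (36 * k)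
  have hkdiv : 36 * k / 36 = k := by omega
  dsimp only at hdeg hWg
  rw [hkdiv] at hdeg hWg
  have hli := linearIndependent_shift_cubicWitness (K := K) (36 * k) k
  rw [hWg] at hli
  have hcard := Thm42Strict.card_le_card_support_mul_two_pow hle A b g
    (hdeg.trans totalDegree_cubicWitness_le) _ hli
  rw [Fintype.card_coe, Finset.card_powersetCard, Finset.card_univ, Fintype.card_fin] at hcard
  have h35 := pow_le_choose_of_le k k le_rfl
  have h8 : (2 : ℕ) ^ (3 * k) = 8 ^ k := by rw [pow_mul]; norm_num
  rw [h8] at hcard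
  have hfin := (h35.trans hcard).trans (Nat.mul_le_mul_right _ hsupp)
  exact absurd (lt_of_le_of_lt hfin hlt) (lt_irrefl _)

end Thm42StrictAll

end MS2021

/-- **MS Thm 42, strictness of the second inclusion (`MS2021_thm_42_strict`), DISCHARGED** for every
infinite field: `ΣΠ^{GLaff}(F) ⊊ ΣΠΣ(F)` (the inclusion is `MS2021_thm_42_incl_holds`).
[cite: MediniShpilka2021, Thm 42 (CCC 2021 LIPIcs 200:19, p.19:14; = arXiv:2102.05632 Thm 1.26, p0008:L70-L72; proof §6 p0034:L10-L26)] -/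
theorem MS2021_thm_42_strict_holds : MS2021_thm_42_strict :=
  fun K _ _ => MS2021.Thm42StrictAll.sigmaPiAffClass_ne_spsClass K

end Literature.Computability.AlgebraicComplexity

end
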